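import Literature.Analysis.FluidPDE.KatoLocalLerayPressure
import Literature.Analysis.FluidPDE.KatoWeakForm
import Literature.Analysis.FluidPDE.VeryWeakToDistributional
import Literature.Analysis.FluidPDE.RieszPressureSpaceTime
import HarnessLib

/-!
# Discharge of `kato_distributional_slab` (Lemarié-Rieusset 2016, Def. 6.2 / (6.13) / Prop. 6.5)

Analysis/FluidPDE proof file (theorems only) **discharging the named fact**
`Literature.Analysis.FluidPDE.kato_distributional_slab` (**D** of `KatoLocalLerayPressure.lean`):
for `ν > 0`, a Kato solution `u` on `[0, T)` (`IsKatoSolutionOn T ν u₀ u`: mild in duality form,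
`u ∈ C([0,T); L³)`, `u 0 = u₀`, measurable on the strip) and `0 < S < T`, there is a pressure `p`
with `(u, p)` a distributional solution of the unforced Navier–Stokes equations on the open slab
`(0, S) × ℝ³` (`IsDistributionalNSSolutionOn`) and `∫₀ˢ∫ |p|^{3/2} < ∞` — `kato_distributional_slab_holds`.
With it the whole chain of `KatoLocalLerayPressure.lean` closes: Thm. 15.1 (A) of
Lemarié-Rieusset (the mild `L³` solution is a local Leray solution, the named fact
`kato_isLocalLeraySolutionOn`) and its two halves `kato_suitable_slab`,
`kato_uniformLocalGradient_slab` are now theorems (`…_holds` below).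

The proof assembles the three bridges of the DAG, all proved in the tree:

* **very weak form** (`KatoWeakForm.lean`, `IsKatoSolutionOn.integral_weakForm_eq_zero`,
  Fabes–Jones–Rivière 1972, Thm. 2.1; Lemarié-Rieusset Def. 6.2): the momentum equation of the
  Kato solution tested with divergence-free fields on the slab, and the space–time divergence
  constraint (`IsKatoSolutionOn.setIntegral_inner_gradient_eq_zero`);
* **the pressure as a function of `(t, x)`** (`RieszPressureSpaceTime.lean`,
  `exists_spaceTime_rieszPressure`, Lemarié-Rieusset Prop. 6.5 / Def. 6.9 / Prop. 6.2 with Stein's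
  `L^{3/2}` bound): along the curve `u ∈ C([0,S]; L³)` the Riesz pressures `Π[u(t)]` have a
  jointly measurable representative `p ∈ L^{3/2}((0,S) × ℝ³)` solving the weak Poisson equation
  slice-wise for a.e. `t`;
* **very weak + Riesz pressure ⇒ distributional** (`VeryWeakToDistributional.lean`,
  `isDistributionalNSSolutionOn_slab_of_veryWeak`, the compactly supported realisation of
  Lemma 6.3 / (6.13) / Prop. 6.5).

The glue proved here is Fubini bookkeeping on the slab: the iterated weak form of
`KatoWeakForm.lean` in the product-measure form, and the slice-wise weak Poisson equation in the
space–time form `∫∫ p Δθ = -∫∫ D²θ(u, u)`.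

## Mathlib / tree search

Tree (all used): `IsKatoSolutionOn.mono`, `.continuousInLpOn` (`KatoMaximalTime`);
`IsKatoSolutionOn.memLp_three_strip`, `.integral_weakForm_eq_zero`,
`.setIntegral_inner_gradient_eq_zero` (`KatoWeakForm`); `exists_spaceTime_rieszPressure`
(`RieszPressureSpaceTime`); `isDistributionalNSSolutionOn_slab_of_veryWeak`,
`integrable_veryWeakIntegrand`, `integrable_veryWeak_terms`, `veryWeakIntegrand`,
`locallyIntegrableOn_slab_of_memLp`, `memLp_norm_sq_of_memLp_three`
(`VeryWeakToDistributional`); `integrable_mul_of_locallyIntegrableOn` (`SuitableWeakPressure`);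
`inner_fderiv_gradient_apply`, `laplacian_slice_eq_zero_of_notMem_tsupport`
(`DistributionalPressurePoisson`); `volume_restrict_prod_univ_eq_prod` (`KatoUniquenessDual`);
`kato_suitable_slab_of_distributional`, `kato_uniformLocalGradient_slab_of_distributional`,
`kato_isLocalLeraySolutionOn_of_distributional` (`KatoLocalLerayPressure`). Mathlib:
`integral_prod`, `eLpNorm_lt_top_iff_lintegral_rpow_enorm_lt_top`.

## References

* P. G. Lemarié-Rieusset, *The Navier–Stokes Problem in the 21st Century*, CRC Press 2016,
  doi:10.1201/b19556 (file pages of the held copy): Def. 6.2 and Lemma 6.3 (p. 126), Prop. 6.2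
  (p. 130), (6.13) (p. 135), Prop. 6.5 and Def. 6.9 (p. 136), Thm. 15.1 (A) and its proof
  (p. 565). [LemarieRieusset2016]
* E. B. Fabes, B. F. Jones, N. M. Rivière, Arch. Rational Mech. Anal. 45 (1972), Thm. 2.1.
  [FabesJonesRiviere1972]
* E. M. Stein, *Singular integrals and differentiability properties of functions* (1970), Ch. II
  §4.2 Thm. 3. [Stein1971]
-/

noncomputable section

open MeasureTheory TopologicalSpace Set Function Filter Topology Metric InnerProductSpace
open scoped ENNReal NNReal RealInnerProductSpace Laplacian

namespace Literature.Analysis.FluidPDE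

/-- Local notation for physical space `ℝ³ = EuclideanSpace ℝ (Fin 3)`. -/
local notation "ℝ³" => EuclideanSpace ℝ (Fin 3)

/-! ### Fubini bookkeeping on the slab `(0, S) × ℝ³` -/

section Fubini

variable {S ν : ℝ} {u : ℝ → ℝ³ → ℝ³} {p : ℝ → ℝ³ → ℝ}

/-- An integrable function on `ℝ × ℝ³` integrates over a slab `s × ℝ³` as an iterated integral.
[folklore] -/
theorem setIntegral_prod_univ_eq_integral_integral {F : ℝ × ℝ³ → ℝ} (s : Set ℝ)
    (hF : Integrable F (volume : Measure (ℝ × ℝ³))) :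
    ∫ z in s ×ˢ (univ : Set ℝ³), F z = ∫ t in s, ∫ x, F (t, x) := by
  have hle : (volume.restrict s).prod (volume : Measure ℝ³) ≤ volume := by
    rw [← volume_restrict_prod_univ_eq_prod]; exact Measure.restrict_le_self
  rw [volume_restrict_prod_univ_eq_prod]
  exact integral_prod F (hF.mono_measure hle)

/-- **The very weak form in the product-measure form** from the iterated form of
`KatoWeakForm.lean` (the integrand is integrable on `ℝ × ℝ³` for `u, |u|² ∈ L¹_loc` of the slab).
[folklore] -/
theorem setIntegral_veryWeak_eq_zero_of_iterated
    (hu1 : LocallyIntegrableOn (uncurry u)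
      ((slab ℝ³ (Ioo 0 S) isOpen_Ioo : Opens (ℝ × ℝ³)) : Set (ℝ × ℝ³)) volume)
    (hu2 : LocallyIntegrableOn (fun z => ‖uncurry u z‖ ^ 2)
      ((slab ℝ³ (Ioo 0 S) isOpen_Ioo : Opens (ℝ × ℝ³)) : Set (ℝ × ℝ³)) volume)
    {ψ : ℝ → ℝ³ → ℝ³} (hψ : IsSpaceTimeTestOn (slab ℝ³ (Ioo 0 S) isOpen_Ioo) ψ)
    (h : ∫ t in Ioo 0 S, ∫ x, (⟪u t x, timeDeriv ψ t x⟫ + ⟪u t x, convect (u t) (ψ t) x⟫ +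
      ν * ⟪u t x, Δ (ψ t) x⟫) = 0) :
    ∫ z in Ioo 0 S ×ˢ (univ : Set ℝ³), (⟪u z.1 z.2, timeDeriv ψ z.1 z.2⟫ +
      ⟪u z.1 z.2, convect (u z.1) (ψ z.1) z.2⟫ + ν * ⟪u z.1 z.2, Δ (ψ z.1) z.2⟫) = 0 := by
  have hW := integrable_veryWeakIntegrand hu1 hu2 hψ ν
  have e := setIntegral_prod_univ_eq_integral_integral (Ioo 0 S) hW
  change ∫ z in Ioo 0 S ×ˢ (univ : Set ℝ³), veryWeakIntegrand ν u ψ z = 0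
  rw [e]
  exact h

/-- **The weak pressure Poisson equation in the space–time form** from its slice-wise form for
a.e. `t ∈ (0, S)`: `∫∫ p Δθ = -∫∫ D²θ(u, u)` for every `θ ∈ C_c^∞((0,S) × ℝ³)` (Fubini twice; the
Hessian term is the convective term against `∇θ`). [folklore] -/
theorem setIntegral_pressure_laplacian_eq_of_ae_slice
    (hu1 : LocallyIntegrableOn (uncurry u)
      ((slab ℝ³ (Ioo 0 S) isOpen_Ioo : Opens (ℝ × ℝ³)) : Set (ℝ × ℝ³)) volume)
    (hu2 : LocallyIntegrableOn (fun z => ‖uncurry u z‖ ^ 2)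
      ((slab ℝ³ (Ioo 0 S) isOpen_Ioo : Opens (ℝ × ℝ³)) : Set (ℝ × ℝ³)) volume)
    (hp1 : LocallyIntegrableOn (uncurry p)
      ((slab ℝ³ (Ioo 0 S) isOpen_Ioo : Opens (ℝ × ℝ³)) : Set (ℝ × ℝ³)) volume)
    (hsl : ∀ᵐ t ∂(volume.restrict (Ioo 0 S)), ∀ φ : ℝ³ → ℝ, ContDiff ℝ (⊤ : ℕ∞) φ →
      HasCompactSupport φ → ∫ x, p t x * (Δ φ) x = -∫ x, fderiv ℝ (fderiv ℝ φ) x (u t x) (u t x))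
    {θ : ℝ → ℝ³ → ℝ} (hθ : IsSpaceTimeTestOn (slab ℝ³ (Ioo 0 S) isOpen_Ioo) θ) :
    ∫ z in Ioo 0 S ×ˢ (univ : Set ℝ³), p z.1 z.2 * Δ (θ z.1) z.2 =
      -∫ z in Ioo 0 S ×ˢ (univ : Set ℝ³), fderiv ℝ (fderiv ℝ (θ z.1)) z.2 (u z.1 z.2) (u z.1 z.2) := by
  -- integrability of both integrands on `ℝ × ℝ³`
  have h2 := hθ.laplacian_isSpaceTimeTestOn
  have IpΔ : Integrable (fun z : ℝ × ℝ³ => p z.1 z.2 * Δ (θ z.1) z.2) (volume : Measure (ℝ × ℝ³)) :=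
    integrable_mul_of_locallyIntegrableOn (F := uncurry p) hp1 (w := uncurry fun t => Δ (θ t))
      h2.contDiff.continuous hθ.hasCompactSupport hθ.tsupport_subset
      fun z hz => laplacian_slice_eq_zero_of_notMem_tsupport hz
  have hθ2 : ∀ t, ContDiff ℝ 2 (θ t) := fun t => (hθ.contDiff_slice t).of_le (by norm_cast)
  obtain ⟨-, Ic, -⟩ := integrable_veryWeak_terms hu1 hu2 hθ.gradient_isSpaceTimeTestOn 0
  have IH : Integrable (fun z : ℝ × ℝ³ => fderiv ℝ (fderiv ℝ (θ z.1)) z.2 (u z.1 z.2) (u z.1 z.2))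
      (volume : Measure (ℝ × ℝ³)) := by
    refine Ic.congr (Eventually.of_forall fun z => ?_)
    exact inner_fderiv_gradient_apply (hθ2 z.1) z.2 (u z.1 z.2)
  rw [setIntegral_prod_univ_eq_integral_integral (Ioo 0 S) IpΔ,
    setIntegral_prod_univ_eq_integral_integral (Ioo 0 S) IH, ← integral_neg]
  refine integral_congr_ae ?_
  filter_upwards [hsl] with t ht
  exact ht (θ t) (hθ.contDiff_slice t) (hθ.hasCompactSupport_slice t)

end Fubini

/-! ### The discharge -/

/-- **Discharge of `kato_distributional_slab`** (Lemarié-Rieusset 2016: Def. 6.2 with Lemma 6.3,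
(6.13), Prop. 6.5 with Def. 6.9 and Prop. 6.2; Fabes–Jones–Rivière 1972, Thm. 2.1; Stein 1970,
Ch. II §4.2 Thm. 3). For `ν > 0`, a Kato solution `u` on `[0, T)` and `0 < S < T`: the space–time
Riesz pressure `p` of the curve `u ∈ C([0,S]; L³)` (`exists_spaceTime_rieszPressure`) makes
`(u, p)` a distributional solution on the open slab `(0, S) × ℝ³`
(`isDistributionalNSSolutionOn_slab_of_veryWeak`, fed with the very weak form of
`KatoWeakForm.lean` and the space–time forms of the divergence constraint and of the weak
Poisson equation), and `∫₀ˢ∫ |p|^{3/2} < ∞`.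
[cite: LemarieRieusset2016, Def. 6.2 with Lemma 6.3 (file p. 126), (6.13) (p. 135), Prop. 6.5 with Def. 6.9 (p. 136) and Prop. 6.2 (p. 130)]
[cite: FabesJonesRiviere1972, Thm. 2.1] [cite: Stein1971, Ch. II §4.2 Thm. 3] -/
theorem kato_distributional_slab_holds : kato_distributional_slab := by
  intro ν T u₀ u hν hu S hS hST
  have huS : IsKatoSolutionOn S ν u₀ u := hu.mono hST.le
  have hu3 : MemLp (uncurry u) 3 (volume.restrict (Ioo 0 S ×ˢ (univ : Set ℝ³))) :=
    hu.memLp_three_strip hST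
  have hcont : ContinuousInLpOn (Icc 0 S) 3 u :=
    hu.continuousInLpOn.mono (Icc_subset_Ico_right hST)
  obtain ⟨p, hpm, hp32, hsl⟩ := exists_spaceTime_rieszPressure hS hcont
  -- local integrability on the open slab
  have hu1 : LocallyIntegrableOn (uncurry u)
      ((slab ℝ³ (Ioo 0 S) isOpen_Ioo : Opens (ℝ × ℝ³)) : Set (ℝ × ℝ³)) volume :=
    locallyIntegrableOn_slab_of_memLp hu3 (by norm_num)
  have h32 : (1 : ℝ≥0∞) ≤ 3 / 2 :=
    ((ENNReal.lt_div_iff_mul_lt (Or.inl (by norm_num)) (Or.inl (by norm_num))).2 (by norm_num)).le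
  have hu2 : LocallyIntegrableOn (fun z => ‖uncurry u z‖ ^ 2)
      ((slab ℝ³ (Ioo 0 S) isOpen_Ioo : Opens (ℝ × ℝ³)) : Set (ℝ × ℝ³)) volume :=
    locallyIntegrableOn_slab_of_memLp (memLp_norm_sq_of_memLp_three hu3) h32
  have hp1 : LocallyIntegrableOn (uncurry p)
      ((slab ℝ³ (Ioo 0 S) isOpen_Ioo : Opens (ℝ × ℝ³)) : Set (ℝ × ℝ³)) volume :=
    locallyIntegrableOn_slab_of_memLp hp32 h32
  have hsl' : ∀ᵐ t ∂(volume.restrict (Ioo 0 S)), ∀ φ : ℝ³ → ℝ, ContDiff ℝ (⊤ : ℕ∞) φ →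
      HasCompactSupport φ → ∫ x, p t x * (Δ φ) x = -∫ x, fderiv ℝ (fderiv ℝ φ) x (u t x) (u t x) := by
    filter_upwards [hsl] with t ht using ht.2.2.2
  refine ⟨p, ?_, ?_⟩
  · refine isDistributionalNSSolutionOn_slab_of_veryWeak hu3 hp32 (fun θ hθ => ?_) (fun θ hθ => ?_)
      (fun ψ hψ hdiv => ?_)
    · exact huS.setIntegral_inner_gradient_eq_zero hθ
    · exact setIntegral_pressure_laplacian_eq_of_ae_slice hu1 hu2 hp1 hsl' hθ
    · exact setIntegral_veryWeak_eq_zero_of_iterated hu1 hu2 hψ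
        (huS.integral_weakForm_eq_zero hν hψ hdiv)
  · -- `∫∫ |p|^{3/2} < ∞`
    have h32ne : (3 / 2 : ℝ≥0∞) ≠ 0 := by norm_num
    have h32top : (3 / 2 : ℝ≥0∞) ≠ ⊤ := by
      rw [ENNReal.div_eq_inv_mul]; exact ENNReal.mul_ne_top (by simp) (by simp)
    have e32 : (3 / 2 : ℝ≥0∞).toReal = 3 / 2 := by rw [ENNReal.toReal_div]; norm_num
    have h := (eLpNorm_lt_top_iff_lintegral_rpow_enorm_lt_top h32ne h32top).1 hp32.2
    rw [e32] at h
    exact h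

/-- **A₁ proved**: the mild `L³` solution is suitable on every interior slab, with an
`L^{3/2}_loc` pressure (`kato_suitable_slab`, `KatoLocalLeraySlab.lean`; Lemarié-Rieusset 2016,
proof of Thm. 15.1 (A), file p. 565). [cite: LemarieRieusset2016, Thm. 15.1 (A), proof (file p. 565)] -/
theorem kato_suitable_slab_holds : kato_suitable_slab :=
  kato_suitable_slab_of_distributional kato_distributional_slab_holds

/-- **A₂ proved**: the uniformly local gradient bound up to `t = 0` for the mild `L³` solution
(`kato_uniformLocalGradient_slab`, `KatoLocalLeraySlab.lean`; Lemarié-Rieusset 2016, proof of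
Thm. 15.1 (A) with the proof of Thm. 14.2, p. 499).
[cite: LemarieRieusset2016, Thm. 15.1 (A), proof (file p. 565); Thm. 14.2, proof (p. 499)] -/
theorem kato_uniformLocalGradient_slab_holds : kato_uniformLocalGradient_slab :=
  kato_uniformLocalGradient_slab_of_distributional kato_distributional_slab_holds

/-- **Thm. 15.1 (A) of Lemarié-Rieusset proved**: the mild `L³` solution (Kato solution) is a
local Leray solution on every slab `(0, S) × ℝ³`, `S < T` — the named fact
`kato_isLocalLeraySolutionOn` of `LocalLerayWeakStrong.lean`.
[cite: LemarieRieusset2016, Thm. 15.1 (A) and its proof (file p. 565)] -/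
theorem kato_isLocalLeraySolutionOn_holds : kato_isLocalLeraySolutionOn :=
  kato_isLocalLeraySolutionOn_of_distributional kato_distributional_slab_holds

end Literature.Analysis.FluidPDE
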